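import Summits.QuantumFields.BalabanUV.T4Continuum.Support.NE7BlockAxialGauge
import Summits.QuantumFields.BalabanUV.T4Continuum.Support.NE7IteratedAverageSegment
import Summits.QuantumFields.BalabanUV.T4Continuum.Support.NE3CpushGaugeCovariance
import HarnessLib

/-!
# NE7AxialGaugeData — BRICK N1 OF THE REP♭ ROAD, ASSEMBLED: IN THE FIBRE OVER THE TRIVIAL DATUM THE BLOCK-ROOTED AXIAL GAUGE KEEPS THE FIBRE, PUTS EVERY
# LINK WITHIN `O(M²ε)` OF `1`, AND SEES EVERY LEVEL-`j` DATUM `cavgIter L j` WITHIN `O(M²ε)` OF `1` — the starting point `L(0)` and the intrinsic `β₀` of the sup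
# induction (memo ROAD v2 §2), from the plaquette radius `ε` and the top constraint ALONE, uniformly in `k` and in the number of blocks

Cell `pub-balaban`, sub-cell t4, lineage `b2b-balaban-t4-ne7-p1`, gen 73 (CRUX PROVER NE7 #1).  Assembly of this gen's N1a `NE7BlockAxialGauge.exists_blockAxialGauge`
(the pinned gauge and its link letters: inside `≤ (d+1)(M−1)ε`, across a face `=` the top corner segment `+ (M+1)(d+1)(M−1)ε`) and N1b
`NE7IteratedAverageSegment.norm_cavgIter_sub_seg_le(_top)` (iterated average `=` corner segment `+ S_i(ε)`, `S_i(ε) := Σ_{m≤i} L^{i−m}·4·loopRad(radIter m ε)`), with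
row NE3's gauge covariance `NE3CpushGaugeCovariance.cavgIter_gaugeAct` (pinned ⇒ the top datum is unchanged).  WHAT ([folklore]; 0 def, 0 sorry; dimension `d + 1`,
`L ≥ 1`, top blocks `M = L^{k+1}`, period `M·N`):
§1 `inside_of_lt` — along a level-`(i+1)` corner segment (`L^{i+1} ∣ M`) every link but the last is an inside link (divisibility).  §2 `norm_seg_sub_one_le` — hence such a
segment of a configuration whose inside links are within `a` and ALL links within `b` of `1` is within `(L^{i+1} − 1)·a + b` of `1`.  §3 THE END
**`exists_axialGauge_data`**: for unitary `(M·N)`-periodic `U` with plaquette radius `ε` in `LevelSmall (d+1) L k ε` and `cavgIter L (k+1) U = flat`, there is a unitary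
periodic `u`, `u(M•y) = 1`, with `V := U^{u}`: (o) `cavgIter L (k+1) V = flat`; (i) inside links `‖V − 1‖ ≤ (d+1)(M−1)ε`; (ii) ALL links
`‖V − 1‖ ≤ (M+1)(d+1)(M−1)ε + S_k(ε)`; (iii) for every `i ≤ k`: `‖cavgIter L (i+1) V (y, ν) − 1‖ ≤ (L^{i+1} − 1)(d+1)(M−1)ε + [(M+1)(d+1)(M−1)ε + S_k(ε)] + S_i(ε)` — all
`O((d+1)·M²ε) = O((d+1)δ)` at `ε = δ∕M²` since `S_i(ε) ≤ S_k(ε) = O(d²·L·M²ε)` in the class (the closed form is the successor's one-liner over `NE3ClassRadiusFamily`).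
HONEST FRAMING (page 1): kinematics + row NE3's letters BY NAME; nothing printed asserted ([B8] (1.65) p. 87 is the TEXT LOCATION of «all averages stay `11d²α₀`-close»);
no Landau gauge; REP♭ NOT proved; (APE) at the trivial flat datum conditional on it; NOT NE7; spine 0∕9; finite T⁴ rung (B)+1 — NOT infinite volume, NOT mass gap, NOT
BetaPertH, NOT Clay.  Continuum YM on T⁴ ⇐ BetaPertH ∧ nine spine estimates (0/9 proved); BetaPertH ⇐ (D1) ∧ (D4) ∧ CAP+tail; G-an2-4 gates asym, D1 and NE2/3/4.
-/

set_option autoImplicit false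

open scoped BigOperators Matrix Matrix.Norms.L2Operator
open Finset

namespace Summit.QuantumFields.BalabanUV.T4Continuum.NE7AxialGaugeData

open Literature.MathematicalPhysics.QuantumFieldTheory.Balaban1983to89
open B7Prop1Explicit B7Prop2Explicit
open T4AveragingDeficitWall (IsUnitaryCfg SmallField)
open T4AveragingDeficitWallBoundary (IsPeriodicCfg)
open AveragingDeficitTransport (mem_U1_of_unitary)
open AveragingDeficitMultiLevelPrep (cavgIter LevelSmall radIter)
open BlockAveragePushDirSplit (flat)
open SpreadLift (loopRad)
open NE3AxialGaugeLadder (smallField_gaugeAct)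
open NE3FramePotBoundW (levelSmall_of_le)
open NE3CpushGaugeCovariance (cavgIter_gaugeAct)
open NE7BlockAxialGauge (exists_blockAxialGauge sub_emod_eq)
open NE7IteratedAverageSegment (norm_cavgIter_sub_seg_le norm_cavgIter_sub_seg_le_top)

noncomputable section

variable {d : ℕ} {n : Type} [Fintype n] [DecidableEq n] [Nonempty n]

/-! ## §1 Along a level corner segment every link but the last is an inside link -/

omit [Fintype n] [DecidableEq n] [Nonempty n] in
/-- if `Q ∣ M`, `p_ν` is a multiple of `Q` and `t + 1 < Q`, then `(p_ν + t) mod M ≠ M − 1`. [folklore] -/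
theorem inside_of_lt {M Q : ℕ} (hQM : Q ∣ M) {p : ℤ} (hp : (Q : ℤ) ∣ p) {t : ℕ} (ht : t + 1 < Q) :
    (p + (t : ℤ)) % (M : ℤ) ≠ (M : ℤ) - 1 := by
  intro h
  have hdec : p + (t : ℤ) + 1 = (M : ℤ) * ((p + (t : ℤ)) / (M : ℤ) + 1) := by
    have := Int.mul_ediv_add_emod (p + (t : ℤ)) (M : ℤ); rw [h] at this; linarith
  have hM : (M : ℤ) ∣ p + (t : ℤ) + 1 := ⟨_, hdec⟩
  have hQ : (Q : ℤ) ∣ p + (t : ℤ) + 1 := (Int.natCast_dvd_natCast.mpr hQM).trans hM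
  have hQt : (Q : ℤ) ∣ ((t + 1 : ℕ) : ℤ) := by
    have : ((t + 1 : ℕ) : ℤ) = (p + (t : ℤ) + 1) - p := by push_cast; ring
    rw [this]; exact dvd_sub hQ hp
  have hle : Q ≤ t + 1 := Nat.le_of_dvd (Nat.succ_pos t) (Int.natCast_dvd_natCast.mp hQt)
  omega

/-! ## §2 A level corner segment of a configuration with good inside links -/

/-- if every link `(y, ν)` with `y_ν mod M ≠ M − 1` is within `a` of `1` and every link within `b`, then for `Q ∣ M`, `Q ≥ 1` and a corner `p` with `Q ∣ p_ν`:
`‖V(p; [p, p + Qe_ν]) − 1‖ ≤ (Q − 1)·a + b`. [folklore] -/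
theorem norm_seg_sub_one_le {V : Site (d + 1) → Fin (d + 1) → (Matrix n n ℂ)ˣ} (hV : IsUnitaryCfg V) {M Q : ℕ} (hQM : Q ∣ M) (hQ : 1 ≤ Q)
    {a b : ℝ} (ha : ∀ (y : Site (d + 1)) (ν : Fin (d + 1)), y ν % (M : ℤ) ≠ (M : ℤ) - 1 → ‖((V y ν : (Matrix n n ℂ)ˣ) : Matrix n n ℂ) - 1‖ ≤ a)
    (hb : ∀ (y : Site (d + 1)) (ν : Fin (d + 1)), ‖((V y ν : (Matrix n n ℂ)ˣ) : Matrix n n ℂ) - 1‖ ≤ b)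
    (p : Site (d + 1)) (ν : Fin (d + 1)) (hp : (Q : ℤ) ∣ p ν) :
    ‖((hol V p (seg ν (Q : ℤ)) : (Matrix n n ℂ)ˣ) : Matrix n n ℂ) - 1‖ ≤ ((Q : ℝ) - 1) * a + b := by
  have hU1 : ∀ z μ, V z μ ∈ U1 (Matrix n n ℂ) := fun z μ => mem_U1_of_unitary (hV z μ)
  obtain ⟨Q', hQ'⟩ : ∃ Q', Q = Q' + 1 := ⟨Q - 1, by omega⟩
  subst hQ'
  -- the first `Q'` links are inside links
  have hfirst : ‖((hol V p (seg ν (Q' : ℤ)) : (Matrix n n ℂ)ˣ) : Matrix n n ℂ) - 1‖ ≤ (Q' : ℝ) * a := by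
    refine NE3NestedBlockMeanCovariance.norm_hol_seg_sub_one_le hV (lo := p) (hi := p + (Q' : ℤ) • e ν) (b := a) ?_ le_rfl le_rfl
    intro y μ hlo hhi
    -- `y = p + t e_ν`, `μ = ν`, `t + 1 ≤ Q'`
    have hμ : μ = ν := by
      by_contra hne
      have h1 := hlo μ; have h2 := hhi μ
      simp [Pi.add_apply, e_apply, hne] at h1 h2
      linarith
    subst hμ
    have h1 := hlo μ; have h2 := hhi μ
    simp [Pi.add_apply, e_apply] at h1 h2
    obtain ⟨t, ht⟩ : ∃ t : ℕ, y μ = p μ + (t : ℤ) := ⟨(y μ - p μ).toNat, by rw [Int.toNat_of_nonneg (by linarith)]; ring⟩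
    have htQ : t + 1 < Q' + 1 := by
      have : (t : ℤ) + 1 ≤ Q' := by linarith
      omega
    refine ha y μ ?_
    rw [ht]
    exact inside_of_lt hQM hp htQ
  rw [Nat.cast_succ, hol_seg_natCast_succ, Units.val_mul]
  calc _ ≤ ‖((hol V p (seg ν (Q' : ℤ)) : (Matrix n n ℂ)ˣ) : Matrix n n ℂ) - 1‖ + ‖((V (p + (Q' : ℤ) • e ν) ν : (Matrix n n ℂ)ˣ) : Matrix n n ℂ) - 1‖ :=
        B8Ineq170.norm_mul_sub_one_le_of_norm_le_one (mem_U1.mp (hol_mem hU1 _ _)).1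
    _ ≤ (Q' : ℝ) * a + b := add_le_add hfirst (hb _ _)
    _ = ((((Q' + 1 : ℕ) : ℝ)) - 1) * a + b := by push_cast; ring

/-! ## §3 THE END -/

/-- **N1 ASSEMBLED — THE PINNED AXIAL GAUGE AND ITS DATA IN THE FIBRE OVER THE TRIVIAL DATUM** (dimension `d + 1`, `L ≥ 1`, `M = L^{k+1}`): for unitary `(M·N)`-periodic
`U` with plaquette radius `ε ≥ 0` in `LevelSmall (d+1) L k ε` and `cavgIter L (k+1) U = flat`, there is a unitary `(M·N)`-periodic site gauge `u` with `u(M•y) = 1` such that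
`V := U^{u}` satisfies (o) `cavgIter L (k+1) V = flat`, (i) inside links `≤ (d+1)(M−1)ε`, (ii) all links `≤ (M+1)(d+1)(M−1)ε + S_k(ε)`, (iii) for `i ≤ k` the level data
`‖cavgIter L (i+1) V (y,ν) − 1‖ ≤ (L^{i+1} − 1)(d+1)(M−1)ε + ((M+1)(d+1)(M−1)ε + S_k(ε)) + S_i(ε)`, `S_i(ε) = Σ_{m≤i} L^{i−m}·4·loopRad(d+1, L, radIter m ε)`. [folklore] -/
theorem exists_axialGauge_data {L : ℕ} (hL : 1 ≤ L) (k N : ℕ) {U : Site (d + 1) → Fin (d + 1) → (Matrix n n ℂ)ˣ} (hU : IsUnitaryCfg U)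
    {ε : ℝ} (hε : 0 ≤ ε) (hs : LevelSmall (d + 1) L k ε) (hUε : SmallField U ε)
    (hUP : IsPeriodicCfg U ((L ^ (k + 1) * N : ℕ) : ℤ)) (hflat : cavgIter L (k + 1) U = flat) :
    ∃ u : Site (d + 1) → (Matrix n n ℂ)ˣ,
      (∀ x, u x ∈ unitaryUnits (Matrix n n ℂ)) ∧
      (∀ (x : Site (d + 1)) (i : Fin (d + 1)), u (x + ((L ^ (k + 1) * N : ℕ) : ℤ) • e i) = u x) ∧
      (∀ y : Site (d + 1), u (((L ^ (k + 1) : ℕ) : ℤ) • y) = 1) ∧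
      cavgIter L (k + 1) (gaugeAct u U) = flat ∧
      (∀ (x : Site (d + 1)) (κ : Fin (d + 1)), x κ % ((L ^ (k + 1) : ℕ) : ℤ) ≠ ((L ^ (k + 1) : ℕ) : ℤ) - 1 →
        ‖((gaugeAct u U x κ : (Matrix n n ℂ)ˣ) : Matrix n n ℂ) - 1‖ ≤ ((d + 1 : ℕ) : ℝ) * (((L ^ (k + 1) : ℕ) : ℝ) - 1) * ε) ∧
      (∀ (x : Site (d + 1)) (κ : Fin (d + 1)),
        ‖((gaugeAct u U x κ : (Matrix n n ℂ)ˣ) : Matrix n n ℂ) - 1‖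
          ≤ ((((L ^ (k + 1) : ℕ) : ℝ) + 1) * (((d + 1 : ℕ) : ℝ) * (((L ^ (k + 1) : ℕ) : ℝ) - 1)) * ε
            + ∑ m ∈ Finset.range (k + 1), (L : ℝ) ^ (k - m) * (4 * loopRad (d + 1) L (radIter (d + 1) L m ε)))) ∧
      (∀ i : ℕ, i ≤ k → ∀ (y : Site (d + 1)) (ν : Fin (d + 1)),
        ‖((cavgIter L (i + 1) (gaugeAct u U) y ν : (Matrix n n ℂ)ˣ) : Matrix n n ℂ) - 1‖
          ≤ ((((L ^ (i + 1) : ℕ) : ℝ) - 1) * (((d + 1 : ℕ) : ℝ) * (((L ^ (k + 1) : ℕ) : ℝ) - 1) * ε)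
            + (((((L ^ (k + 1) : ℕ) : ℝ) + 1) * (((d + 1 : ℕ) : ℝ) * (((L ^ (k + 1) : ℕ) : ℝ) - 1)) * ε
              + ∑ m ∈ Finset.range (k + 1), (L : ℝ) ^ (k - m) * (4 * loopRad (d + 1) L (radIter (d + 1) L m ε))))
            + ∑ m ∈ Finset.range (i + 1), (L : ℝ) ^ (i - m) * (4 * loopRad (d + 1) L (radIter (d + 1) L m ε)))) := by
  set M : ℕ := L ^ (k + 1) with hM
  haveI : NeZero M := ⟨by rw [hM]; exact pow_ne_zero _ (by omega)⟩
  obtain ⟨u, huU, huP, hu1, hin, hface, hseg⟩ :=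
    exists_blockAxialGauge M hU hε hUε hUP (P := ((M * N : ℕ) : ℤ)) ⟨N, by push_cast; ring⟩
  set V := gaugeAct u U with hV
  -- `V` is unitary, `ε`-small, and has the same top datum
  have hVu : IsUnitaryCfg V := fun z κ =>
    (unitaryUnits _).mul_mem ((unitaryUnits _).mul_mem (huU z) (hU z κ)) ((unitaryUnits _).inv_mem (huU _))
  have hVε : SmallField V ε := smallField_gaugeAct huU hUε
  have hVflat : cavgIter L (k + 1) V = flat := by
    rw [hV, cavgIter_gaugeAct hL k hU hε hs hUε huU, hflat]
    have h1 : (fun w : Site (d + 1) => u (((L : ℤ) ^ (k + 1)) • w)) = fun _ => (1 : (Matrix n n ℂ)ˣ) := by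
      funext w
      have := hu1 w
      rwa [hM, Nat.cast_pow] at this
    rw [h1]
    funext y κ
    simp [gaugeAct]
  -- the top corner segments are within `S_k` of `1`
  set Sk : ℝ := ∑ m ∈ Finset.range (k + 1), (L : ℝ) ^ (k - m) * (4 * loopRad (d + 1) L (radIter (d + 1) L m ε)) with hSk
  have htop : ∀ (x : Site (d + 1)) (κ : Fin (d + 1)),
      ‖((hol V (fun i => x i - x i % (M : ℤ)) (seg κ (M : ℤ)) : (Matrix n n ℂ)ˣ) : Matrix n n ℂ) - 1‖ ≤ Sk := by
    intro x κ
    have hy : (fun i => x i - x i % (M : ℤ)) = (M : ℤ) • (fun i => x i / (M : ℤ)) := by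
      funext i; rw [sub_emod_eq]; simp [Pi.smul_apply]
    have h := norm_cavgIter_sub_seg_le_top hL k hVu hε hs hVε (fun i => x i / (M : ℤ)) κ
    rw [hVflat] at h
    rw [hy, hM, Nat.cast_pow]
    simpa [flat, hM] using h
  -- all links
  have hall : ∀ (x : Site (d + 1)) (κ : Fin (d + 1)),
      ‖((V x κ : (Matrix n n ℂ)ˣ) : Matrix n n ℂ) - 1‖ ≤ ((M : ℝ) + 1) * (((d + 1 : ℕ) : ℝ) * ((M : ℝ) - 1)) * ε + Sk := by
    intro x κ
    have hM1 : (1 : ℝ) ≤ M := by exact_mod_cast Nat.one_le_iff_ne_zero.mpr (NeZero.ne M)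
    have hbig : ((d + 1 : ℕ) : ℝ) * ((M : ℝ) - 1) * ε ≤ ((M : ℝ) + 1) * (((d + 1 : ℕ) : ℝ) * ((M : ℝ) - 1)) * ε := by
      have h0 : 0 ≤ ((d + 1 : ℕ) : ℝ) * ((M : ℝ) - 1) * ε := by
        have : (0 : ℝ) ≤ (M : ℝ) - 1 := by linarith
        positivity
      nlinarith
    have hSk0 : 0 ≤ Sk := (norm_nonneg _).trans (htop x κ)
    by_cases h : x κ % (M : ℤ) = (M : ℤ) - 1
    · calc _ ≤ ‖((V x κ : (Matrix n n ℂ)ˣ) : Matrix n n ℂ) - ((hol V (fun i => x i - x i % (M : ℤ)) (seg κ (M : ℤ)) : (Matrix n n ℂ)ˣ) : Matrix n n ℂ)‖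
            + ‖((hol V (fun i => x i - x i % (M : ℤ)) (seg κ (M : ℤ)) : (Matrix n n ℂ)ˣ) : Matrix n n ℂ) - 1‖ := by
            rw [← sub_add_sub_cancel]; exact norm_add_le _ _
        _ ≤ _ := add_le_add (hface x κ h) (htop x κ)
    · exact (hin x κ h).trans (by linarith)
  refine ⟨u, huU, huP, ?_, hVflat, hin, hall, fun i hi y ν => ?_⟩
  · intro y; have := hu1 y; rwa [hM] at this
  -- level data
  have hVi := norm_cavgIter_sub_seg_le hL i hVu hε (levelSmall_of_le hi hs) hVε y ν
  have hQM : L ^ (i + 1) ∣ M := by rw [hM]; exact pow_dvd_pow L (by omega)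
  have hsegi := norm_seg_sub_one_le hVu hQM (Nat.one_le_iff_ne_zero.mpr (pow_ne_zero _ (by omega))) hin hall
    ((((L ^ (i + 1) : ℕ) : ℤ)) • y) ν ⟨y ν, by simp [Pi.smul_apply]⟩
  calc _ ≤ ‖((cavgIter L (i + 1) V y ν : (Matrix n n ℂ)ˣ) : Matrix n n ℂ)
          - ((hol V (((L ^ (i + 1) : ℕ) : ℤ) • y) (seg ν ((L ^ (i + 1) : ℕ) : ℤ)) : (Matrix n n ℂ)ˣ) : Matrix n n ℂ)‖
        + ‖((hol V (((L ^ (i + 1) : ℕ) : ℤ) • y) (seg ν ((L ^ (i + 1) : ℕ) : ℤ)) : (Matrix n n ℂ)ˣ) : Matrix n n ℂ) - 1‖ := by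
        rw [← sub_add_sub_cancel]; exact norm_add_le _ _
    _ ≤ _ := by linarith [hVi, hsegi]

end

end Summit.QuantumFields.BalabanUV.T4Continuum.NE7AxialGaugeData
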